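import Mathlib.GroupTheory.Index
import Mathlib.GroupTheory.IndexNSmul
import Mathlib.Analysis.SpecialFunctions.Pow.Real
import Mathlib.Tactic
import Literature.Algebra.EuclideanLattices.IntegerBases
import Literature.Algebra.EuclideanLattices.IntegerLatticeTheta
import Literature.Algebra.EuclideanLattices.DualLatticeProofs
import Literature.Algebra.EuclideanLattices.SuccessiveMinimaProofs
import Literature.Algebra.EuclideanLattices.SuccessiveMinimaHermiteConstant
import Literature.Algebra.EuclideanLattices.SuccessiveMinimaHermiteSetProofs
import HarnessLib

/-!
# A short integer functional on `ℤ^D` vanishing modulo the index on a finite-index subgroup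

Topic `Literature/Algebra/EuclideanLattices` (geometry of numbers; consumer: venture QEC, cell `qec`, the proof of
the Bravyi–Terhal bound on lattice quotients `ℤ^D/Λ` of Arnault–Gaborit–Rozendaal–Saussay–Zémor 2026,
`Literature/InformationTheory/QuantumCodes/LatticeQuotientDistanceBound.lean`). Everything here is PROVED; no
definitions, no named facts.

* `exists_short_integer_functional_of_finiteIndex` — for `Λ ≤ ℤ^D` of finite index `n` (`D ≥ 1`) there is
  `w ∈ ℤ^D ∖ 0` with `⟨Λ, w⟩ ⊆ nℤ` and `Σ wᵢ² ≤ γ_D · (n^{(D−1)/D})²`: Hermite's inequality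
  (`minNorm_sq_le_hermiteConstant_mul_holds`, with the tree's `hermiteConstant`) for the DUAL lattice of
  `Λ ⊆ ℝ^D` (covolume `1/n` by `covolume_dualLattice_holds` and Mathlib's
  `ZLattice.covolume_div_covolume_eq_relIndex'`), scaled by `n`. It is the dual form of
  [ArnaultEtAl2026, Lemmas 3.8–3.9] and replaces their Rankin-constant / Gram–Schmidt argument.
* `abs_sub_dotProduct_le` — two integer points in a closed ball of radius `ρ` pair with `w` to within `2ρ‖w‖`
  (private helpers: coordinates of the embedding `intVecToEuclidean D : ℤ^D → ℝ^D` of `IntegerBases.lean`).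

References: F. Arnault, P. Gaborit, W. Rozendaal, N. Saussay, G. Zémor, *A Variant of the Bravyi–Terhal Bound for
Arbitrary Boundary Conditions*, IEEE Trans. Inform. Theory 72 (2026) 437–446 = arXiv:2502.04995 [ArnaultEtAl2026],
§3.2 Def. 3.3 (Hermite constant), §3.4 Lemmas 3.8–3.9, 3.12 (chunks p0006–p0009); J. W. S. Cassels, *An Introduction
to the Geometry of Numbers*, Ch. II §3 [Cassels1997] (Hermite's constant; the tree's `SuccessiveMinima.lean`).
-/

noncomputable section

namespace Literature.Algebra.EuclideanLattices

open Module Submodule MeasureTheory Finset Matrix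
open scoped InnerProductSpace

/-! ### The short dual functional -/

/-- **A short integer functional vanishing on a finite-index subgroup of `ℤ^D` modulo its index.** If
`Λ ≤ ℤ^D` (`D ≥ 1`) has finite index `n`, there is a non-zero `w ∈ ℤ^D` with `⟨g, w⟩ ∈ nℤ` for every `g ∈ Λ`
and `‖w‖² = Σ wᵢ² ≤ γ_D · n^{2(D−1)/D}`, `γ_D = hermiteConstant D`. Proof: `Λ ⊗ ℝ ⊆ ℤ^D ⊆ ℝ^D` is a full
lattice of covolume `n` (`ZLattice.covolume_div_covolume_eq_relIndex'`, `covol(ℤ^D) = 1`), its dual lattice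
`Λ*` has covolume `1/n` (`covolume_dualLattice_holds`) and contains `ℤ^D`, hence a non-zero vector `y` with
`‖y‖² = λ₁(Λ*)² ≤ γ_D · n^{−2/D}` (attainment `exists_mem_norm_eq_minNorm_holds` and the definition of the Hermite
constant, `minNorm_sq_le_hermiteConstant_mul_holds`); `w := n·y` is integral because `n·ℤ^D ⊆ Λ`. This is the
dual form of [ArnaultEtAl2026, Lemmas 3.8–3.9] (there: a basis `u_1,…,u_D` of `Λ` whose last Gram–Schmidt
vector has `‖u*_D‖ ≥ n^{1/D}/√γ_D`, obtained from Rankin's `γ_{D,D−1} = γ_D`; here `y = u*_D/‖u*_D‖²` is replaced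
by a shortest dual vector, which needs only Hermite's inequality for `Λ*`).
[cite: ArnaultEtAl2026, §3.4 Lemmas 3.8–3.9 (arXiv:2502.04995 chunk p0007 L11–36)]
[cite: Cassels1997, Ch. II §3 (Hermite's constant: λ₁(L)² ≤ γ_D covol(L)^{2/D})] -/
theorem exists_short_integer_functional_of_finiteIndex {D : ℕ} (hD : 1 ≤ D)
    (Λ : AddSubgroup (Fin D → ℤ)) [Λ.FiniteIndex] :
    ∃ w : Fin D → ℤ, w ≠ 0 ∧ (∀ g ∈ Λ, (Λ.index : ℤ) ∣ g ⬝ᵥ w) ∧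
      ∑ i, (w i : ℝ) ^ 2 ≤ hermiteConstant D * ((Λ.index : ℝ) ^ (((D : ℝ) - 1) / D)) ^ 2 := by
  classical
  have hn0 : Λ.index ≠ 0 := AddSubgroup.FiniteIndex.index_ne_zero
  have hnpos : (0 : ℝ) < Λ.index := by exact_mod_cast Nat.pos_of_ne_zero hn0
  -- the ambient lattice `L₂ = ℤ^D ⊆ ℝ^D` and the coefficient isomorphism `Φ : ℤ^D ≃ L₂`
  let bR : Basis (Fin D) ℝ (EuclideanSpace ℝ (Fin D)) := (EuclideanSpace.basisFun (Fin D) ℝ).toBasis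
  set L₂ : Submodule ℤ (EuclideanSpace ℝ (Fin D)) := span ℤ (Set.range bR) with hL₂
  let bZ : Basis (Fin D) ℤ L₂ := bR.restrictScalars ℤ
  let Φ : (Fin D → ℤ) ≃ₗ[ℤ] L₂ := bZ.equivFun.symm
  have hΦ : ∀ e : Fin D → ℤ, ((Φ e : L₂) : EuclideanSpace ℝ (Fin D)) = intVecToEuclidean D e :=
    fun e => coe_equivFun_symm_eq_toLp D e
  -- the sublattice `L₁ = Φ(Λ)`
  set L₁ : Submodule ℤ (EuclideanSpace ℝ (Fin D)) :=
    ((AddSubgroup.toIntSubmodule Λ).map (Φ : (Fin D → ℤ) →ₗ[ℤ] L₂)).map L₂.subtype with hL₁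
  have hle : L₁ ≤ L₂ := by
    intro v hv
    rw [hL₁, Submodule.mem_map] at hv
    obtain ⟨w, -, rfl⟩ := hv
    exact w.2
  have hmemL₁ : ∀ {e : Fin D → ℤ}, e ∈ Λ → intVecToEuclidean D e ∈ L₁ := by
    intro e he
    rw [hL₁, Submodule.mem_map]
    exact ⟨Φ e, Submodule.mem_map.2 ⟨e, (show e ∈ Λ.toIntSubmodule from he), rfl⟩, hΦ e⟩
  have hmemL₁' : ∀ {v : EuclideanSpace ℝ (Fin D)}, v ∈ L₁ → ∃ e ∈ Λ, intVecToEuclidean D e = v := by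
    intro v hv
    rw [hL₁, Submodule.mem_map] at hv
    obtain ⟨w, hw, hwv⟩ := hv
    rw [Submodule.mem_map] at hw
    obtain ⟨e, he, hew⟩ := hw
    exact ⟨e, he, by rw [← hwv, ← hew]; exact (hΦ e).symm⟩
  -- `L₁` is a full lattice
  haveI hdisc₂ : DiscreteTopology L₂ := (inferInstance : DiscreteTopology (span ℤ (Set.range bR)))
  haveI hlat₂ : IsZLattice ℝ L₂ := (inferInstance : IsZLattice ℝ (span ℤ (Set.range bR)))
  haveI hdisc : DiscreteTopology L₁ :=
    DiscreteTopology.of_subset (s := (L₂ : Set (EuclideanSpace ℝ (Fin D)))) hdisc₂ hle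
  haveI hlat : IsZLattice ℝ L₁ := by
    refine ⟨?_⟩
    rw [eq_top_iff, ← bR.span_eq, Submodule.span_le]
    rintro _ ⟨i, rfl⟩
    have hK : Λ.index • (Pi.single i 1 : Fin D → ℤ) ∈ Λ := AddSubgroup.nsmul_index_mem Λ _
    have hmem : ((Λ.index : ℝ) • bR i) ∈ L₁ := by
      have h := hmemL₁ hK
      have heq : intVecToEuclidean D (Λ.index • (Pi.single i 1 : Fin D → ℤ)) = (Λ.index : ℝ) • bR i := by
        ext j
        simp [bR, intVecToEuclidean_apply, Pi.single_apply]
      rwa [heq] at h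
    have hk : (Λ.index : ℝ) ≠ 0 := by exact_mod_cast hn0
    have : bR i = (Λ.index : ℝ)⁻¹ • ((Λ.index : ℝ) • bR i) := by
      rw [smul_smul, inv_mul_cancel₀ hk, one_smul]
    rw [SetLike.mem_coe, this]
    exact Submodule.smul_mem _ _ (Submodule.subset_span hmem)
  -- covolumes: `covol L₂ = 1`, `covol L₁ = n`, `covol L₁* = 1/n`
  have hcov₂ : ZLattice.covolume L₂ = 1 := covolume_span_basisFun D
  have hrel : L₁.toAddSubgroup.relIndex L₂.toAddSubgroup = Λ.index := by
    rw [AddSubgroup.relIndex]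
    have hsub : L₁.toAddSubgroup.addSubgroupOf L₂.toAddSubgroup
        = Λ.map (Φ : (Fin D → ℤ) ≃ₗ[ℤ] L₂).toAddMonoidHom := by
      ext w
      simp only [AddSubgroup.mem_addSubgroupOf, Submodule.mem_toAddSubgroup, AddSubgroup.mem_map,
        LinearMap.toAddMonoidHom_coe, LinearEquiv.coe_coe]
      constructor
      · intro hw
        rw [hL₁, Submodule.mem_map] at hw
        obtain ⟨w', hw', hww⟩ := hw
        have : w' = w := Subtype.ext hww
        subst this
        rw [Submodule.mem_map] at hw'
        obtain ⟨e', he', rfl⟩ := hw'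
        exact ⟨e', (show e' ∈ Λ from he'), rfl⟩
      · rintro ⟨e', he', rfl⟩
        rw [hL₁, Submodule.mem_map]
        exact ⟨Φ e', Submodule.mem_map.2 ⟨e', (show e' ∈ Λ.toIntSubmodule from he'), rfl⟩, rfl⟩
    rw [hsub]
    exact AddSubgroup.index_map_of_bijective (LinearEquiv.bijective _) Λ
  have hcov₁ : ZLattice.covolume L₁ = Λ.index := by
    have hquot := ZLattice.covolume_div_covolume_eq_relIndex' L₁ L₂ hle
    rw [hrel, hcov₂, div_one] at hquot
    exact hquot
  have hcovd : ZLattice.covolume (dualLattice L₁) = (Λ.index : ℝ)⁻¹ := by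
    rw [← hcov₁]; exact covolume_dualLattice_holds L₁
  -- the dual lattice is nonzero: it contains `ℤ^D ∋ e_0`
  have hL₂le : L₂ ≤ dualLattice L₁ := by
    have := dualLattice_anti hle
    rwa [hL₂, dualLattice_span_basisFun D] at this
  have hne : dualLattice L₁ ≠ ⊥ := by
    obtain ⟨i⟩ : Nonempty (Fin D) := ⟨⟨0, hD⟩⟩
    intro hbot
    have hmem : bR i ∈ dualLattice L₁ := hL₂le (Submodule.subset_span ⟨i, rfl⟩)
    rw [hbot, Submodule.mem_bot] at hmem
    exact bR.ne_zero i hmem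
  -- a shortest dual vector and Hermite's inequality
  obtain ⟨y, hy, hy0, hynorm⟩ := exists_mem_norm_eq_minNorm_holds (dualLattice L₁) hne
  have hH := minNorm_sq_le_hermiteConstant_mul_holds (dualLattice L₁)
  rw [hcovd, ← hynorm] at hH
  -- integrality of `n • y`
  have hinner : ∀ e : Fin D → ℤ, ⟪y, intVecToEuclidean D e⟫_ℝ = ∑ j, y j * e j := by
    intro e
    rw [EuclideanSpace.inner_eq_star_dotProduct]
    simp [dotProduct, mul_comm]
  have hw : ∀ i, ∃ k : ℤ, (k : ℝ) = Λ.index * y i := by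
    intro i
    have hmem : intVecToEuclidean D (Λ.index • (Pi.single i 1 : Fin D → ℤ)) ∈ L₁ :=
      hmemL₁ (AddSubgroup.nsmul_index_mem Λ _)
    obtain ⟨k, hk⟩ := mem_dualLattice.1 hy _ hmem
    refine ⟨k, ?_⟩
    rw [hk, hinner]
    simp [Pi.single_apply, mul_comm]
  choose w hw using hw
  refine ⟨w, ?_, ?_, ?_⟩
  · -- `w ≠ 0`
    intro hw0
    apply hy0
    ext i
    have := hw i
    rw [hw0, Pi.zero_apply, Int.cast_zero] at this
    have hyi : y i = 0 := by
      rcases mul_eq_zero.1 this.symm with h | h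
      · exact absurd h (by exact_mod_cast hn0)
      · exact h
    simp [hyi]
  · -- `n ∣ ⟨g, w⟩` for `g ∈ Λ`
    intro g hg
    obtain ⟨k, hk⟩ := mem_dualLattice.1 hy _ (hmemL₁ hg)
    refine ⟨k, ?_⟩
    have : ((g ⬝ᵥ w : ℤ) : ℝ) = Λ.index * k := by
      rw [hk, hinner, Finset.mul_sum]
      push_cast [dotProduct]
      refine Finset.sum_congr rfl fun j _ => ?_
      rw [hw j]; ring
    exact_mod_cast this
  · -- the norm bound
    have hsum : ∑ i, (w i : ℝ) ^ 2 = (Λ.index : ℝ) ^ 2 * ‖y‖ ^ 2 := by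
      rw [EuclideanSpace.real_norm_sq_eq, Finset.mul_sum]
      refine Finset.sum_congr rfl fun i _ => ?_
      rw [hw i]; ring
    rw [hsum]
    have hD0 : (D : ℝ) ≠ 0 := by exact_mod_cast (by omega : D ≠ 0)
    have hexp : ((Λ.index : ℝ) ^ (((D : ℝ) - 1) / D)) ^ 2
        = (Λ.index : ℝ) ^ 2 * ((Λ.index : ℝ)⁻¹) ^ (2 / (D : ℝ)) := by
      rw [← Real.rpow_natCast ((Λ.index : ℝ) ^ (((D : ℝ) - 1) / D)) 2, ← Real.rpow_mul hnpos.le,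
        Real.inv_rpow hnpos.le, ← Real.rpow_neg hnpos.le, ← Real.rpow_natCast (Λ.index : ℝ) 2,
        ← Real.rpow_add hnpos]
      congr 1
      push_cast
      field_simp
      ring
    rw [hexp]
    calc (Λ.index : ℝ) ^ 2 * ‖y‖ ^ 2
        ≤ (Λ.index : ℝ) ^ 2 * (hermiteConstant D * ((Λ.index : ℝ)⁻¹) ^ (2 / (D : ℝ))) := by
          gcongr
      _ = hermiteConstant D * ((Λ.index : ℝ) ^ 2 * ((Λ.index : ℝ)⁻¹) ^ (2 / (D : ℝ))) := by ring




/-! ### Euclidean facts on `ℤ^D ⊆ ℝ^D` -/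


variable {D : ℕ}

/-- `⟪ι x, ι w⟫ = ⟨x, w⟩` for the embedding `ι = intVecToEuclidean D : ℤ^D → ℝ^D`. [folklore] -/
private theorem intVecToEuclidean_inner_eq_dotProduct (x w : Fin D → ℤ) :
    ⟪intVecToEuclidean D x, intVecToEuclidean D w⟫_ℝ = ((x ⬝ᵥ w : ℤ) : ℝ) := by
  rw [EuclideanSpace.inner_eq_star_dotProduct]
  simp [dotProduct, mul_comm]

/-- `‖ι x − ι c‖² = Σᵢ (xᵢ − cᵢ)²`. [folklore] -/
private theorem intVecToEuclidean_sub_norm_sq_eq_sum (x c : Fin D → ℤ) :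
    ‖intVecToEuclidean D x - intVecToEuclidean D c‖ ^ 2 = ∑ i, ((x i : ℝ) - c i) ^ 2 := by
  rw [EuclideanSpace.real_norm_sq_eq]
  simp

/-- `‖ι w‖² = Σᵢ wᵢ²`. [folklore] -/
private theorem intVecToEuclidean_norm_sq_eq_sum (w : Fin D → ℤ) :
    ‖intVecToEuclidean D w‖ ^ 2 = ∑ i, (w i : ℝ) ^ 2 := by
  rw [EuclideanSpace.real_norm_sq_eq]
  simp

/-- **Two integer points in a closed Euclidean ball of radius `ρ` pair with `w` to within `2ρ‖w‖`**:
`Σ(xᵢ − cᵢ)² ≤ ρ²`, `Σ(x'ᵢ − cᵢ)² ≤ ρ²` ⟹ `|⟨x, w⟩ − ⟨x', w⟩| ≤ 2ρ‖w‖` (triangle inequality and Cauchy–Schwarz);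
the Lipschitz step behind «the distance separating any two qubits of `S` is less than `2ρ`» in
[ArnaultEtAl2026, Lemma 3.12]. [cite: ArnaultEtAl2026, §3.4 Lemma 3.12 (arXiv:2502.04995 chunk p0009 L29–34)] -/
theorem abs_sub_dotProduct_le {ρ : ℝ} (hρ : 0 ≤ ρ) {x x' c w : Fin D → ℤ}
    (hx : ∑ i, ((x i : ℝ) - c i) ^ 2 ≤ ρ ^ 2) (hx' : ∑ i, ((x' i : ℝ) - c i) ^ 2 ≤ ρ ^ 2) :
    |((x ⬝ᵥ w : ℤ) : ℝ) - ((x' ⬝ᵥ w : ℤ) : ℝ)| ≤ 2 * ρ * Real.sqrt (∑ i, (w i : ℝ) ^ 2) := by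
  set X := intVecToEuclidean D x
  set X' := intVecToEuclidean D x'
  set C := intVecToEuclidean D c
  set W := intVecToEuclidean D w
  have hW : ‖W‖ = Real.sqrt (∑ i, (w i : ℝ) ^ 2) := by
    rw [← intVecToEuclidean_norm_sq_eq_sum, Real.sqrt_sq (norm_nonneg _)]
  have h1 : ‖X - C‖ ≤ ρ := by
    have := Real.sqrt_le_sqrt ((intVecToEuclidean_sub_norm_sq_eq_sum x c).le.trans hx)
    rwa [Real.sqrt_sq (norm_nonneg _), Real.sqrt_sq hρ] at this
  have h2 : ‖X' - C‖ ≤ ρ := by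
    have := Real.sqrt_le_sqrt ((intVecToEuclidean_sub_norm_sq_eq_sum x' c).le.trans hx')
    rwa [Real.sqrt_sq (norm_nonneg _), Real.sqrt_sq hρ] at this
  have h3 : ‖X - X'‖ ≤ 2 * ρ := by
    calc ‖X - X'‖ = ‖(X - C) - (X' - C)‖ := by congr 1; abel
      _ ≤ ‖X - C‖ + ‖X' - C‖ := norm_sub_le _ _
      _ ≤ ρ + ρ := add_le_add h1 h2
      _ = 2 * ρ := by ring
  have hin : ((x ⬝ᵥ w : ℤ) : ℝ) - ((x' ⬝ᵥ w : ℤ) : ℝ) = ⟪X - X', W⟫_ℝ := by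
    rw [inner_sub_left, intVecToEuclidean_inner_eq_dotProduct, intVecToEuclidean_inner_eq_dotProduct]
  rw [hin, ← hW]
  calc |⟪X - X', W⟫_ℝ| ≤ ‖X - X'‖ * ‖W‖ := abs_real_inner_le_norm _ _
    _ ≤ 2 * ρ * ‖W‖ := by gcongr




/-! ### `γ_D ≥ 1` -/

/-- **`γ_D ≥ 1` for `D ≥ 1`**: the integer lattice `ℤ^D ⊆ ℝ^D` (`stdIntLattice D`) has `λ₁(ℤ^D) = 1`
(a non-zero integer vector has an integer coordinate of absolute value `≥ 1`; `e₀` has norm `1`) and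
covolume `1` (`covolume_span_basisFun`), so its Hermite invariant is `1 ∈ hermiteSet D`, and
`γ_D = sup hermiteSet D ≥ 1` (`bddAbove_hermiteSet_holds`). Immediate from the definition of the Hermite
constant as a supremum over all lattices [cite: Cassels1997, Ch. II §3 (definition of γ_n; the lattice ℤⁿ)];
used by `Literature/InformationTheory/QuantumCodes/AbelianTwoBlockDistanceBound.lean` to make the printed bound
`2√γ_D(√D + 4)n^{(D−1)/D} ≥ 1` explicit. -/
theorem one_le_hermiteConstant {D : ℕ} (hD : 1 ≤ D) : 1 ≤ hermiteConstant D := by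
  have h0mem : intVecToEuclidean D (Pi.single ⟨0, hD⟩ 1) ∈ stdIntLattice D :=
    intVecToEuclidean_mem_stdIntLattice _ _
  have h0ne : intVecToEuclidean D (Pi.single ⟨0, hD⟩ 1) ≠ 0 := by
    intro h
    have := congrArg (fun v : EuclideanSpace ℝ (Fin D) => v ⟨0, hD⟩) h
    simp at this
  have h0norm : ‖intVecToEuclidean D (Pi.single ⟨0, hD⟩ 1)‖ = 1 := by
    rw [norm_intVecToEuclidean, Finset.sum_eq_single ⟨0, hD⟩ (fun j _ hj => by simp [hj]) (by simp)]
    simp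
  have hmin : minNorm (stdIntLattice D) = 1 := by
    apply le_antisymm
    · refine csInf_le ⟨0, ?_⟩ ⟨_, ⟨h0mem, h0ne⟩, h0norm⟩
      rintro _ ⟨y, -, rfl⟩
      exact norm_nonneg _
    · refine le_csInf ⟨_, _, ⟨h0mem, h0ne⟩, rfl⟩ ?_
      rintro _ ⟨x, ⟨hx, hx0⟩, rfl⟩
      obtain ⟨j, hj⟩ : ∃ j, x j ≠ 0 := by
        by_contra h
        push Not at h
        exact hx0 (PiLp.ext fun j => by simpa using h j)
      obtain ⟨k, hk⟩ := (mem_stdIntLattice_iff x).1 hx j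
      have hk0 : k ≠ 0 := by
        rintro rfl
        exact hj (by rw [← hk, Int.cast_zero])
      have h1 : 1 ≤ (x j) ^ 2 := by
        have h1' : (1 : ℤ) ≤ k ^ 2 := (one_le_sq_iff_one_le_abs _).2 (Int.one_le_abs hk0)
        have h1'' : ((1 : ℤ) : ℝ) ≤ ((k ^ 2 : ℤ) : ℝ) := Int.cast_le.2 h1'
        rw [Int.cast_one, Int.cast_pow, hk] at h1''
        exact h1''
      have h2 : (x j) ^ 2 ≤ ‖x‖ ^ 2 := by
        rw [EuclideanSpace.real_norm_sq_eq]
        exact Finset.single_le_sum (f := fun i => (x i) ^ 2) (fun i _ => sq_nonneg _) (Finset.mem_univ j)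
      nlinarith [norm_nonneg x]
  have hmem : (1 : ℝ) ∈ hermiteSet D := by
    refine ⟨stdIntLattice D, inferInstance, inferInstance, ?_⟩
    have hcov : ZLattice.covolume (stdIntLattice D) = 1 := covolume_span_basisFun D
    rw [hmin, hcov, one_pow, Real.one_rpow, div_one]
  exact le_csSup (bddAbove_hermiteSet_holds D) hmem

end Literature.Algebra.EuclideanLattices

end
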